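import Summits.QuantumFields.YangMills.Theorems.ToronValleyVolumeZeroModeDefs

/-!
# Zero-mode quartic of the toron valley, II: symmetrisation over the largest column and splitting it off

For the Gaussian-regularised zero-mode integral `Z₄(β)` (file `ToronValleyVolumeZeroModeDefs`): with `F = exp(−βQ₄ − Σ‖c_μ‖²/2)`,
`4·∫_{strict argmax = 4} F ≤ ∫ F ≤ 4·∫_{argmax = 4} F` (column permutations are measure preserving and `Q₄` is permutation
invariant; no null-set argument is needed), and after the split `c = snoc x a` (Tonelli) the two sides become `4∫ Φ⁻(β,a) da` and
`4∫ Φ⁺(β,a) da` with the conditional integrals `Φ±(β,a) = ∫_{‖x_μ‖ <(≤) ‖a‖} exp(−βQ₄(x,a) − (‖x‖²+‖a‖²)/2) dx`.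

HONEST LABEL: helper analysis for a plan-only BC5 rung (`stub_rung_zeroModeLog4`) of crux ⟨stmt-QuantumFields-24497⟩ on a
DRAFT-by-design sub-route (`ToronValleyVolume`, LINE g15-B of ym-idea-4); it is NOT in the crux composition; no crux, rung of the
ladder, leaf or summit statement is proved here; the Yang–Mills mass gap is NOT proved by this.
-/

noncomputable section

namespace Summit.QuantumFields.YangMills.Theorems.ToronValleyVolume.ZeroMode

open MeasureTheory Real Finset Set
open scoped ENNReal
open Summit.QuantumFields.YangMills.Cruxes.ToronTubeVolumeLaw.Birth

/-! ## §5 Symmetrisation over the largest column and splitting it off -/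

/-- The `ℝ≥0∞`-valued integrand of `Z₄(β)`. -/
def F4 (β : ℝ) (c : Fin 4 → EuclideanSpace ℝ (Fin 3)) : ℝ≥0∞ := ENNReal.ofReal (zmI 4 β c)

/-- `F4` is measurable. -/
theorem measurable_F4 (β : ℝ) : Measurable (F4 β) := ENNReal.measurable_ofReal.comp (measurable_zmI 4 β)

/-- Column `ν` is (weakly) the largest. -/
def Bmax (ν : Fin 4) : Set (Fin 4 → EuclideanSpace ℝ (Fin 3)) := {c | ∀ μ, ‖c μ‖ ≤ ‖c ν‖}

/-- Column `ν` is strictly the largest. -/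
def Amax (ν : Fin 4) : Set (Fin 4 → EuclideanSpace ℝ (Fin 3)) := {c | ∀ μ, μ ≠ ν → ‖c μ‖ < ‖c ν‖}

/-- `Bmax ν` is measurable (closed). -/
theorem measurableSet_Bmax (ν : Fin 4) : MeasurableSet (Bmax ν) := by
  have : Bmax ν = ⋂ μ, {c : Fin 4 → EuclideanSpace ℝ (Fin 3) | ‖c μ‖ ≤ ‖c ν‖} := by
    ext c; simp [Bmax]
  rw [this]
  exact MeasurableSet.iInter fun μ =>
    measurableSet_le (continuous_norm.comp (continuous_apply μ)).measurable
      (continuous_norm.comp (continuous_apply ν)).measurable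

/-- `Amax ν` is measurable (open). -/
theorem measurableSet_Amax (ν : Fin 4) : MeasurableSet (Amax ν) := by
  have : Amax ν = ⋂ μ, {c : Fin 4 → EuclideanSpace ℝ (Fin 3) | μ ≠ ν → ‖c μ‖ < ‖c ν‖} := by
    ext c; simp [Amax]
  rw [this]
  refine MeasurableSet.iInter fun μ => ?_
  by_cases h : μ = ν
  · have : {c : Fin 4 → EuclideanSpace ℝ (Fin 3) | μ ≠ ν → ‖c μ‖ < ‖c ν‖} = Set.univ := by
      ext c; simp [h]
    rw [this]; exact MeasurableSet.univ
  · have : {c : Fin 4 → EuclideanSpace ℝ (Fin 3) | μ ≠ ν → ‖c μ‖ < ‖c ν‖} = {c | ‖c μ‖ < ‖c ν‖} := by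
      ext c; simp [h]
    rw [this]
    exact measurableSet_lt (continuous_norm.comp (continuous_apply μ)).measurable
      (continuous_norm.comp (continuous_apply ν)).measurable

/-- Pointwise: `F ≤ Σ_ν 𝟙_{Bmax ν} F` (some column is the largest). -/
theorem F4_le_sum_indicator_Bmax (β : ℝ) (c : Fin 4 → EuclideanSpace ℝ (Fin 3)) :
    F4 β c ≤ ∑ ν, (Bmax ν).indicator (F4 β) c := by
  obtain ⟨ν₀, -, hν₀⟩ := Finset.exists_max_image Finset.univ (fun μ => ‖c μ‖) Finset.univ_nonempty
  have hmem : c ∈ Bmax ν₀ := fun μ => hν₀ μ (Finset.mem_univ μ)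
  calc F4 β c = (Bmax ν₀).indicator (F4 β) c := (indicator_of_mem hmem _).symm
    _ ≤ ∑ ν, (Bmax ν).indicator (F4 β) c :=
        Finset.single_le_sum (f := fun ν => (Bmax ν).indicator (F4 β) c) (fun ν _ => zero_le) (Finset.mem_univ ν₀)

/-- Pointwise: `Σ_ν 𝟙_{Amax ν} F ≤ F` (at most one column is strictly the largest). -/
theorem sum_indicator_Amax_le_F4 (β : ℝ) (c : Fin 4 → EuclideanSpace ℝ (Fin 3)) :
    ∑ ν, (Amax ν).indicator (F4 β) c ≤ F4 β c := by
  by_cases h : ∃ ν₀, c ∈ Amax ν₀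
  · obtain ⟨ν₀, hν₀⟩ := h
    have hother : ∀ ν, ν ≠ ν₀ → c ∉ Amax ν := by
      intro ν hν hν'
      have h1 := hν₀ ν hν
      have h2 := hν' ν₀ (Ne.symm hν)
      exact lt_asymm h1 h2
    rw [Finset.sum_eq_single ν₀ (fun ν _ hν => indicator_of_notMem (hother ν hν) _)
      (fun h => (h (Finset.mem_univ _)).elim), indicator_of_mem hν₀]
  · push Not at h
    rw [Finset.sum_eq_zero (fun ν _ => indicator_of_notMem (h ν) _)]
    exact zero_le

/-- The coordinate permutation `c ↦ c ∘ σ` is a measure-preserving map of `(ℝ³)⁴`. -/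
theorem measurePreserving_comp_perm (σ : Equiv.Perm (Fin 4)) :
    MeasurePreserving (fun c : Fin 4 → EuclideanSpace ℝ (Fin 3) => c ∘ σ) volume volume := by
  have h := volume_measurePreserving_piCongrLeft (fun _ : Fin 4 => EuclideanSpace ℝ (Fin 3)) σ.symm
  have hfun : (fun c : Fin 4 → EuclideanSpace ℝ (Fin 3) => c ∘ σ) =
      ⇑(MeasurableEquiv.piCongrLeft (fun _ : Fin 4 => EuclideanSpace ℝ (Fin 3)) σ.symm) := by
    funext c; funext i
    simp [MeasurableEquiv.coe_piCongrLeft, Equiv.piCongrLeft_apply_eq_cast]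
  rw [hfun]; exact h

/-- Transport: `∫ 𝟙_{S ν} F = ∫ 𝟙_{S 3} F` whenever `S ν` is the preimage of `S 3` under the transposition `(ν 3)`
applied to the columns, for a permutation-invariant integrand. -/
theorem lintegral_indicator_perm (β : ℝ) (ν : Fin 4) (S : Fin 4 → Set (Fin 4 → EuclideanSpace ℝ (Fin 3)))
    (hS3 : MeasurableSet (S 3))
    (hS : ∀ c, c ∘ (Equiv.swap ν 3) ∈ S 3 ↔ c ∈ S ν) :
    ∫⁻ c, (S ν).indicator (F4 β) c = ∫⁻ c, (S 3).indicator (F4 β) c := by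
  have hmp := measurePreserving_comp_perm (Equiv.swap ν 3)
  have hmeas : Measurable ((S 3).indicator (F4 β)) := (measurable_F4 β).indicator hS3
  rw [← hmp.lintegral_comp hmeas]
  refine lintegral_congr fun c => ?_
  by_cases hc : c ∈ S ν
  · rw [indicator_of_mem hc, indicator_of_mem ((hS c).2 hc)]
    unfold F4; rw [zmI_perm]
  · rw [indicator_of_notMem hc, indicator_of_notMem (fun h => hc ((hS c).1 h))]

/-- `Bmax ν` is the transposition-preimage of `Bmax 3`. -/
theorem comp_swap_mem_Bmax (ν : Fin 4) (c : Fin 4 → EuclideanSpace ℝ (Fin 3)) :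
    c ∘ (Equiv.swap ν 3) ∈ Bmax 3 ↔ c ∈ Bmax ν := by
  simp only [Bmax, Set.mem_setOf_eq, Function.comp_apply, Equiv.swap_apply_right]
  constructor
  · intro h μ; simpa using h (Equiv.swap ν 3 μ)
  · intro h μ; exact h _

/-- `Amax ν` is the transposition-preimage of `Amax 3`. -/
theorem comp_swap_mem_Amax (ν : Fin 4) (c : Fin 4 → EuclideanSpace ℝ (Fin 3)) :
    c ∘ (Equiv.swap ν 3) ∈ Amax 3 ↔ c ∈ Amax ν := by
  simp only [Amax, Set.mem_setOf_eq, Function.comp_apply, Equiv.swap_apply_right]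
  constructor
  · intro h μ hμ
    have hne : Equiv.swap ν 3 μ ≠ 3 := by
      intro h3
      apply hμ
      have := congrArg (Equiv.swap ν 3) h3
      simpa using this
    simpa using h (Equiv.swap ν 3 μ) hne
  · intro h μ hμ
    refine h _ ?_
    intro h'
    apply hμ
    have := congrArg (Equiv.swap ν 3) h'
    simpa using this

/-- UPPER symmetrisation: `∫ F ≤ 4 · ∫ 𝟙_{Bmax 3} F`. -/
theorem lintegral_F4_le_four_Bmax (β : ℝ) :
    ∫⁻ c, F4 β c ≤ 4 * ∫⁻ c, (Bmax 3).indicator (F4 β) c := by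
  calc ∫⁻ c, F4 β c ≤ ∫⁻ c, ∑ ν, (Bmax ν).indicator (F4 β) c := lintegral_mono (F4_le_sum_indicator_Bmax β)
    _ = ∑ ν, ∫⁻ c, (Bmax ν).indicator (F4 β) c :=
        lintegral_finsetSum _ fun ν _ => (measurable_F4 β).indicator (measurableSet_Bmax ν)
    _ = ∑ ν : Fin 4, ∫⁻ c, (Bmax 3).indicator (F4 β) c :=
        Finset.sum_congr rfl fun ν _ =>
          lintegral_indicator_perm β ν Bmax (measurableSet_Bmax 3) (comp_swap_mem_Bmax ν)
    _ = 4 * ∫⁻ c, (Bmax 3).indicator (F4 β) c := by simp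

/-- LOWER symmetrisation: `4 · ∫ 𝟙_{Amax 3} F ≤ ∫ F`. -/
theorem four_Amax_le_lintegral_F4 (β : ℝ) :
    4 * ∫⁻ c, (Amax 3).indicator (F4 β) c ≤ ∫⁻ c, F4 β c := by
  calc 4 * ∫⁻ c, (Amax 3).indicator (F4 β) c = ∑ ν : Fin 4, ∫⁻ c, (Amax 3).indicator (F4 β) c := by
        simp
    _ = ∑ ν, ∫⁻ c, (Amax ν).indicator (F4 β) c :=
        Finset.sum_congr rfl fun ν _ =>
          (lintegral_indicator_perm β ν Amax (measurableSet_Amax 3) (comp_swap_mem_Amax ν)).symm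
    _ = ∫⁻ c, ∑ ν, (Amax ν).indicator (F4 β) c :=
        (lintegral_finsetSum _ fun ν _ => (measurable_F4 β).indicator (measurableSet_Amax ν)).symm
    _ ≤ ∫⁻ c, F4 β c := lintegral_mono (sum_indicator_Amax_le_F4 β)


/-! ## §6 Splitting off the last column -/

/-- The three remaining columns lie in the closed ball of radius `‖a‖`. -/
def boxLe (a : EuclideanSpace ℝ (Fin 3)) : Set (Fin 3 → EuclideanSpace ℝ (Fin 3)) := {x | ∀ μ, ‖x μ‖ ≤ ‖a‖}

/-- The three remaining columns lie in the open ball of radius `‖a‖`. -/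
def boxLt (a : EuclideanSpace ℝ (Fin 3)) : Set (Fin 3 → EuclideanSpace ℝ (Fin 3)) := {x | ∀ μ, ‖x μ‖ < ‖a‖}

/-- `boxLe a` is measurable. -/
theorem measurableSet_boxLe (a : EuclideanSpace ℝ (Fin 3)) : MeasurableSet (boxLe a) := by
  have : boxLe a = ⋂ μ, {x : Fin 3 → EuclideanSpace ℝ (Fin 3) | ‖x μ‖ ≤ ‖a‖} := by ext x; simp [boxLe]
  rw [this]
  exact MeasurableSet.iInter fun μ =>
    measurableSet_le (continuous_norm.comp (continuous_apply μ)).measurable measurable_const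

/-- `boxLt a` is measurable. -/
theorem measurableSet_boxLt (a : EuclideanSpace ℝ (Fin 3)) : MeasurableSet (boxLt a) := by
  have : boxLt a = ⋂ μ, {x : Fin 3 → EuclideanSpace ℝ (Fin 3) | ‖x μ‖ < ‖a‖} := by ext x; simp [boxLt]
  rw [this]
  exact MeasurableSet.iInter fun μ =>
    measurableSet_lt (continuous_norm.comp (continuous_apply μ)).measurable measurable_const

/-- Auxiliary: `boxLt_subset_boxLe`. -/
theorem boxLt_subset_boxLe (a : EuclideanSpace ℝ (Fin 3)) : boxLt a ⊆ boxLe a := fun _ hx μ => (hx μ).le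

/-- The map `(a, x) ↦ snoc x a` is the inverse of the measurable splitting equivalence. -/
theorem snoc_eq_piFinSuccAbove_symm :
    (fun p : EuclideanSpace ℝ (Fin 3) × (Fin 3 → EuclideanSpace ℝ (Fin 3)) =>
      (Fin.snoc p.2 p.1 : Fin 4 → EuclideanSpace ℝ (Fin 3))) =
      ⇑(MeasurableEquiv.piFinSuccAbove (fun _ : Fin 4 => EuclideanSpace ℝ (Fin 3)) (Fin.last 3)).symm := by
  funext p
  rw [MeasurableEquiv.piFinSuccAbove_symm_apply]
  exact (Fin.insertNth_last' p.1 p.2).symm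

/-- `(a, x) ↦ snoc x a` is measurable. -/
theorem measurable_snoc_pair :
    Measurable (fun p : EuclideanSpace ℝ (Fin 3) × (Fin 3 → EuclideanSpace ℝ (Fin 3)) =>
      (Fin.snoc p.2 p.1 : Fin 4 → EuclideanSpace ℝ (Fin 3))) := by
  rw [snoc_eq_piFinSuccAbove_symm]; exact MeasurableEquiv.measurable _

/-- The conditional integrand once the last column `a` is split off. -/
def G4 (β : ℝ) (a : EuclideanSpace ℝ (Fin 3)) (x : Fin 3 → EuclideanSpace ℝ (Fin 3)) : ℝ≥0∞ :=
  ENNReal.ofReal (zmI 4 β (Fin.snoc x a))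

/-- `G4` is jointly measurable. -/
theorem measurable_G4_uncurry (β : ℝ) : Measurable (Function.uncurry (G4 β)) := by
  have : Function.uncurry (G4 β) = fun p : EuclideanSpace ℝ (Fin 3) × (Fin 3 → EuclideanSpace ℝ (Fin 3)) =>
      ENNReal.ofReal (zmI 4 β (Fin.snoc p.2 p.1)) := by
    funext p; rfl
  rw [this]
  exact ENNReal.measurable_ofReal.comp ((measurable_zmI 4 β).comp measurable_snoc_pair)

/-- `G4 β a` is measurable for each `a`. -/
theorem measurable_G4 (β : ℝ) (a : EuclideanSpace ℝ (Fin 3)) : Measurable (G4 β a) :=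
  (measurable_G4_uncurry β).of_uncurry_left

/-- UPPER conditional integral `Φ⁺(β,a) = ∫_{‖x_μ‖ ≤ ‖a‖} exp(−βQ₄(x,a) − (‖x‖²+‖a‖²)/2) dx`. -/
def PhiP (β : ℝ) (a : EuclideanSpace ℝ (Fin 3)) : ℝ≥0∞ := ∫⁻ x, (boxLe a).indicator (G4 β a) x

/-- LOWER conditional integral `Φ⁻(β,a)` (strict balls). -/
def PhiM (β : ℝ) (a : EuclideanSpace ℝ (Fin 3)) : ℝ≥0∞ := ∫⁻ x, (boxLt a).indicator (G4 β a) x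

/-- `Φ⁻ ≤ Φ⁺`. -/
theorem PhiM_le_PhiP (β : ℝ) (a : EuclideanSpace ℝ (Fin 3)) : PhiM β a ≤ PhiP β a :=
  lintegral_mono fun x => indicator_le_indicator_of_subset (boxLt_subset_boxLe a) (fun _ => zero_le) x

/-- `snoc x a` has weakly largest last column iff `x ∈ boxLe a`. -/
theorem snoc_mem_Bmax_iff (x : Fin 3 → EuclideanSpace ℝ (Fin 3)) (a : EuclideanSpace ℝ (Fin 3)) :
    (Fin.snoc x a : Fin 4 → EuclideanSpace ℝ (Fin 3)) ∈ Bmax 3 ↔ x ∈ boxLe a := by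
  have h3 : (Fin.snoc x a : Fin 4 → EuclideanSpace ℝ (Fin 3)) (Fin.last 3) = a := Fin.snoc_last _ _
  simp only [Bmax, boxLe, Set.mem_setOf_eq]
  rw [Fin.forall_fin_succ', show (3 : Fin 4) = Fin.last 3 from rfl, h3]
  simp only [Fin.snoc_castSucc, le_refl, and_true]

/-- `snoc x a` has strictly largest last column iff `x ∈ boxLt a`. -/
theorem snoc_mem_Amax_iff (x : Fin 3 → EuclideanSpace ℝ (Fin 3)) (a : EuclideanSpace ℝ (Fin 3)) :
    (Fin.snoc x a : Fin 4 → EuclideanSpace ℝ (Fin 3)) ∈ Amax 3 ↔ x ∈ boxLt a := by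
  have h3 : (Fin.snoc x a : Fin 4 → EuclideanSpace ℝ (Fin 3)) (Fin.last 3) = a := Fin.snoc_last _ _
  simp only [Amax, boxLt, Set.mem_setOf_eq]
  rw [Fin.forall_fin_succ', show (3 : Fin 4) = Fin.last 3 from rfl, h3]
  simp only [Fin.snoc_castSucc, ne_eq, not_true_eq_false, IsEmpty.forall_iff, and_true]
  constructor
  · intro h μ; exact h μ (Fin.castSucc_lt_last μ).ne
  · intro h μ _; exact h μ

/-- Change of variables `c = snoc x a` for a lower integral on `(ℝ³)⁴`, then Tonelli. -/
theorem lintegral_eq_lintegral_snoc (G : (Fin 4 → EuclideanSpace ℝ (Fin 3)) → ℝ≥0∞) (hG : Measurable G) :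
    ∫⁻ c, G c = ∫⁻ a : EuclideanSpace ℝ (Fin 3), ∫⁻ x : Fin 3 → EuclideanSpace ℝ (Fin 3), G (Fin.snoc x a) := by
  have hp := (volume_preserving_piFinSuccAbove (fun _ : Fin 4 => EuclideanSpace ℝ (Fin 3)) (Fin.last 3)).symm
  rw [← hp.lintegral_comp hG, ← snoc_eq_piFinSuccAbove_symm, Measure.volume_eq_prod, lintegral_prod]
  exact (hG.comp measurable_snoc_pair).aemeasurable

/-- The weakly-symmetrised integral is `∫ Φ⁺(β,a) da`. -/
theorem lintegral_Bmax_eq (β : ℝ) : ∫⁻ c, (Bmax 3).indicator (F4 β) c = ∫⁻ a, PhiP β a := by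
  rw [lintegral_eq_lintegral_snoc _ ((measurable_F4 β).indicator (measurableSet_Bmax 3))]
  refine lintegral_congr fun a => lintegral_congr fun x => ?_
  by_cases hx : x ∈ boxLe a
  · rw [indicator_of_mem ((snoc_mem_Bmax_iff x a).2 hx), indicator_of_mem hx]; rfl
  · rw [indicator_of_notMem (fun h => hx ((snoc_mem_Bmax_iff x a).1 h)), indicator_of_notMem hx]

/-- The strictly-symmetrised integral is `∫ Φ⁻(β,a) da`. -/
theorem lintegral_Amax_eq (β : ℝ) : ∫⁻ c, (Amax 3).indicator (F4 β) c = ∫⁻ a, PhiM β a := by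
  rw [lintegral_eq_lintegral_snoc _ ((measurable_F4 β).indicator (measurableSet_Amax 3))]
  refine lintegral_congr fun a => lintegral_congr fun x => ?_
  by_cases hx : x ∈ boxLt a
  · rw [indicator_of_mem ((snoc_mem_Amax_iff x a).2 hx), indicator_of_mem hx]; rfl
  · rw [indicator_of_notMem (fun h => hx ((snoc_mem_Amax_iff x a).1 h)), indicator_of_notMem hx]

/-- ★ UPPER reduction: `∫ F₄ ≤ 4 ∫ Φ⁺(β,a) da`. -/
theorem lintegral_F4_le_four_PhiP (β : ℝ) : ∫⁻ c, F4 β c ≤ 4 * ∫⁻ a, PhiP β a := by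
  rw [← lintegral_Bmax_eq]; exact lintegral_F4_le_four_Bmax β

/-- ★ LOWER reduction: `4 ∫ Φ⁻(β,a) da ≤ ∫ F₄`. -/
theorem four_PhiM_le_lintegral_F4 (β : ℝ) : 4 * ∫⁻ a, PhiM β a ≤ ∫⁻ c, F4 β c := by
  rw [← lintegral_Amax_eq]; exact four_Amax_le_lintegral_F4 β

/-- Joint measurability of the box-indicator integrands. -/
theorem measurable_box_indicator (β : ℝ) (strict : Bool) :
    Measurable (fun p : EuclideanSpace ℝ (Fin 3) × (Fin 3 → EuclideanSpace ℝ (Fin 3)) =>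
      (if strict then boxLt p.1 else boxLe p.1).indicator (G4 β p.1) p.2) := by
  set S : Set (EuclideanSpace ℝ (Fin 3) × (Fin 3 → EuclideanSpace ℝ (Fin 3))) :=
    {p | p.2 ∈ (if strict then boxLt p.1 else boxLe p.1)} with hS
  have hset : MeasurableSet S := by
    cases strict
    · have : S = ⋂ μ, {p : EuclideanSpace ℝ (Fin 3) × (Fin 3 → EuclideanSpace ℝ (Fin 3)) | ‖p.2 μ‖ ≤ ‖p.1‖} := by
        ext p; simp [hS, boxLe]
      rw [this]
      exact MeasurableSet.iInter fun μ => measurableSet_le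
        (continuous_norm.comp ((continuous_apply μ).comp continuous_snd)).measurable
        (continuous_norm.comp continuous_fst).measurable
    · have : S = ⋂ μ, {p : EuclideanSpace ℝ (Fin 3) × (Fin 3 → EuclideanSpace ℝ (Fin 3)) | ‖p.2 μ‖ < ‖p.1‖} := by
        ext p; simp [hS, boxLt]
      rw [this]
      exact MeasurableSet.iInter fun μ => measurableSet_lt
        (continuous_norm.comp ((continuous_apply μ).comp continuous_snd)).measurable
        (continuous_norm.comp continuous_fst).measurable
  have heq : (fun p : EuclideanSpace ℝ (Fin 3) × (Fin 3 → EuclideanSpace ℝ (Fin 3)) =>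
      (if strict then boxLt p.1 else boxLe p.1).indicator (G4 β p.1) p.2) = S.indicator (Function.uncurry (G4 β)) := by
    funext p
    by_cases hp : p.2 ∈ (if strict then boxLt p.1 else boxLe p.1)
    · rw [indicator_of_mem hp, indicator_of_mem (show p ∈ S from hp)]; rfl
    · rw [indicator_of_notMem hp, indicator_of_notMem (show p ∉ S from hp)]
  rw [heq]
  exact (measurable_G4_uncurry β).indicator hset

/-- `Φ⁺` is measurable in `a`. -/
theorem measurable_PhiP (β : ℝ) : Measurable (PhiP β) := by
  have := (measurable_box_indicator β false).lintegral_prod_right'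
    (ν := (volume : Measure (Fin 3 → EuclideanSpace ℝ (Fin 3))))
  have h : PhiP β = fun x => ∫⁻ y, (boxLe x).indicator (G4 β x) y := funext fun a => rfl
  rw [h]; simpa using this

/-- `Φ⁻` is measurable in `a`. -/
theorem measurable_PhiM (β : ℝ) : Measurable (PhiM β) := by
  have := (measurable_box_indicator β true).lintegral_prod_right'
    (ν := (volume : Measure (Fin 3 → EuclideanSpace ℝ (Fin 3))))
  have h : PhiM β = fun x => ∫⁻ y, (boxLt x).indicator (G4 β x) y := funext fun a => rfl
  rw [h]; simpa using this


end Summit.QuantumFields.YangMills.Theorems.ToronValleyVolume.ZeroMode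

end
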